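import Summits.Ventures.CertifiedManyBodySolver.Downfold.EmeryOrbitalWeightAxisBox
import Summits.Ventures.CertifiedManyBodySolver.Downfold.EmeryOrbitalWeightFaceSteps
import HarnessLib

/-!
# ELECTRON-LIKENESS FROM THE VAN HOVE DOPING, and the TWO-SIDED axis-antinode Cu-d weight window over a typed box
# (INFL-3to1-B §B.92 — the device for (box, filling) pairs BEYOND the box's σ Lifshitz filling; companion of `EmeryOrbitalWeightAxisBox` (one-sided ceiling) and
# `EmeryOrbitalWeightFaceSteps` §2 (hole-likeness from `1 − 2ν ≤ x_VH`))

Venture CertifiedManyBodySolver, cell `pub/hubbard-downfold` (stage S1), seat hubbard-downfold-mod-4 (technique B, g41); namespace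
`Summit.Ventures.CertifiedManyBodySolver.Downfold.Emery`. Everything PROVED (0 sorry; one-line order arguments on the landed closed forms). WHAT THIS IS NOT:
a statement about any material; `U = 0` one-body kinematics of the σ (d–pₓ–p_y + t_pp, t_pp′) model.

* §1 `faceG_neg_of_lt_vhEnergy` (an energy strictly below the saddle level has `faceG < 0`), `fermiEnergyOf_lt_vhEnergy` (`ν < abFilling(ε_VH) ⇒ ε_F(ν) < ε_VH`),
  **`faceG_fermiEnergyOf_neg_of_xVH_lt`**: `x_VH(θ) < 1 − 2ν` (the hole doping `x = 1 − 2ν` EXCEEDS the σ van Hove doping) ⇒ `faceG(θ; ε_F(θ; ν)) < 0`, and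
  **`xAxis_fermiEnergyOf_lt_one_of_xVH_lt`**: then `xAxis(θ; ε_F) < 1` — the antibonding band reaches `ε_F` ON the Γ–X axis: the Fermi surface is ELECTRON-LIKE (closed
  around Γ) and its most Cu-like point is the axis crossing (`EmeryOrbitalWeightAxis.dWeight_mem_Icc_node_axis`). Mirror of `faceG_fermiEnergyOf_nonneg_of_xVH`.
* §2 **`dWeightAxis_fermiEnergyOf_mem_Icc_of_mem_box`** — THE TWO-CORNER RULE FOR THE AXIS WEIGHT AT FIXED FILLING: for every member θ = (Δ, a, b, c) of
  `[Δ₁, Δ₂] × [a₁, a₂] × [b₁, b₂] × [c₁, c₂]` at filling `0 < ν < 1`, with the box's bottom / top Fermi energies bracketed (`0 < E_l ≤ ε_F(Δ₂, a₁, b₁, c₂; ν)`,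
  `ε_F(Δ₁, a₂, b₂, c₁; ν) ≤ E_h`, `EmeryFermiEnergyExistsAll.fermiEnergyOf_mem_Icc_of_mem_box'`), `c₂E_h < a₁²` and the energy-lever margin `c₂(2Δ₁E_h + E_h²) ≤ a₁²Δ₁`:
  **`dWeightAxisCF(Δ₁, a₂, c₁; E_h) ≤ w_axis(θ; ε_F(θ; ν)) ≤ dWeightAxisCF(Δ₂, a₁, c₂; E_l)`** (levers Δ ↑, t_pd ↓, t_pp′ ↑, ε ↓ of `EmeryOrbitalWeightAxisBox` §2; no t_pp
  dependence beyond ε_F). The ceiling half is `dWeight_le_axisCF_of_mem_box` read at the axis point; the floor half is new. `…_num`: decimal form for `norm_num` corners.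

Sources: three-band model [HybertsenSchluterChristensen1989, Eq. (1)]; two-level axis decoupling [AndersenEtAl1995, §6]; [folklore] algebra.
-/

noncomputable section

namespace Summit.Ventures.CertifiedManyBodySolver.Downfold.Emery

open Real Set

/-! ## §1 Electron-likeness from the van Hove doping -/

/-- `0 ≤ ε < ε_VH` (with `Δ + 4t_pp′ ≥ 0`) ⇒ `faceG(ε) < 0`: a contour strictly below the saddle level does not reach the zone face. [folklore] -/
theorem faceG_neg_of_lt_vhEnergy {Δ tpd c ε : ℝ} (hD : 0 ≤ Δ + 4 * c) (hε : 0 ≤ ε) (hv : ε < vhEnergy Δ tpd c) : faceG Δ tpd c ε < 0 := by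
  have hq := vhEnergy_quad Δ tpd c
  rw [faceG_eq_quad]
  have : 0 < (vhEnergy Δ tpd c - ε) * (ε + vhEnergy Δ tpd c + (Δ + 4 * c)) := mul_pos (by linarith) (by linarith)
  nlinarith

/-- **A filling strictly below the van Hove filling has its Fermi energy strictly below the saddle level**: `0 < ν < abFilling(ε_VH)` ⇒ `ε_F(ν) < ε_VH`
(`Δ > 0`, `t_pd ≠ 0`, `0 ≤ t_pp′`, `0 ≤ t_pp`). [folklore] -/
theorem fermiEnergyOf_lt_vhEnergy {Δ a b c ν : ℝ} (hΔ : 0 < Δ) (ha : a ≠ 0) (hc : 0 ≤ c) (hb : 0 ≤ b) (hν0 : 0 < ν) (hν1 : ν < 1)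
    (hν : ν < abFilling Δ a b c (vhEnergy Δ a c)) : fermiEnergyOf Δ a b c ν < vhEnergy Δ a c := by
  by_contra hle
  push Not at hle
  have hF := abFilling_fermiEnergyOf' hΔ ha hc hb hν0 hν1
  have hmono := abFilling_mono Δ a b c hle
  linarith

/-- **ELECTRON-LIKENESS FROM THE VAN HOVE DOPING**: `x_VH(θ) < 1 − 2ν` (the hole doping `x = 1 − 2ν` exceeds the σ van Hove doping of the row) ⇒ the Fermi surface of
filling `ν` does NOT reach the zone face: `faceG(θ; ε_F(θ; ν)) < 0`. [folklore] -/
theorem faceG_fermiEnergyOf_neg_of_xVH_lt {Δ a b c ν : ℝ} (hΔ : 0 < Δ) (ha : a ≠ 0) (hc : 0 ≤ c) (hb : 0 ≤ b) (hν0 : 0 < ν) (hν1 : ν < 1)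
    (hx : xVH Δ a b c < 1 - 2 * ν) : faceG Δ a c (fermiEnergyOf Δ a b c ν) < 0 := by
  have hν : ν < abFilling Δ a b c (vhEnergy Δ a c) := by unfold xVH at hx; linarith
  exact faceG_neg_of_lt_vhEnergy (by linarith) (fermiEnergyOf_pos hΔ ha hc hb hν0 hν1).le (fermiEnergyOf_lt_vhEnergy hΔ ha hc hb hν0 hν1 hν)

/-- `faceG(ε) < 0` with `t_pp′ε < t_pd²` ⇒ `xAxis(ε) < 1`: the antibonding band crosses `ε` on the Γ–X axis strictly inside the zone. [folklore] -/
theorem xAxis_lt_one_of_faceG_neg {Δ tpd c ε : ℝ} (hm : c * ε < tpd ^ 2) (hG : faceG Δ tpd c ε < 0) : xAxis Δ tpd c ε < 1 := by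
  unfold xAxis
  unfold faceG at hG
  rw [div_lt_one (by linarith)]
  linarith

/-- **ELECTRON-LIKE TOPOLOGY FROM THE VAN HOVE DOPING**: `x_VH(θ) < 1 − 2ν` and `t_pp′·ε_F < t_pd²` ⇒ `xAxis(θ; ε_F(θ; ν)) < 1` — the Fermi surface is closed around Γ
and its most Cu-like point is the Γ–X axis crossing. [folklore] -/
theorem xAxis_fermiEnergyOf_lt_one_of_xVH_lt {Δ a b c ν : ℝ} (hΔ : 0 < Δ) (ha : a ≠ 0) (hc : 0 ≤ c) (hb : 0 ≤ b) (hν0 : 0 < ν) (hν1 : ν < 1)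
    (hx : xVH Δ a b c < 1 - 2 * ν) (hm : c * fermiEnergyOf Δ a b c ν < a ^ 2) : xAxis Δ a c (fermiEnergyOf Δ a b c ν) < 1 :=
  xAxis_lt_one_of_faceG_neg hm (faceG_fermiEnergyOf_neg_of_xVH_lt hΔ ha hc hb hν0 hν1 hx)

/-! ## §2 The two-corner rule for the axis weight at fixed filling -/

/-- **THE AXIS-WEIGHT WINDOW OVER A TYPED BOX.** For every member `θ = (Δ, a, b, c)` of `[Δ₁, Δ₂] × [a₁, a₂] × [b₁, b₂] × [c₁, c₂]` (`Δ₁ > 0`, `a₁ > 0`, `b₁, c₁ ≥ 0`)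
at filling `0 < ν < 1`, with `0 < E_l ≤ ε_F(Δ₂, a₁, b₁, c₂; ν)`, `ε_F(Δ₁, a₂, b₂, c₁; ν) ≤ E_h`, `c₂E_h < a₁²` and the margin `c₂(2Δ₁E_h + E_h²) ≤ a₁²Δ₁`:
**`dWeightAxisCF(Δ₁, a₂, c₁; E_h) ≤ dWeightAxis(θ; ε_F(θ; ν)) ≤ dWeightAxisCF(Δ₂, a₁, c₂; E_l)`**. For an electron-like member this is the Cu-d weight of its most Cu-like
Fermi point; for any member it bounds every Fermi-surface Bloch state from above (`EmeryOrbitalWeightAxisBox`). [folklore] -/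
theorem dWeightAxis_fermiEnergyOf_mem_Icc_of_mem_box {Δ a b c Δ₁ Δ₂ a₁ a₂ b₁ b₂ c₁ c₂ ν El Eh : ℝ} (hΔ₁ : 0 < Δ₁) (ha₁ : 0 < a₁) (hb₁ : 0 ≤ b₁) (hc₁ : 0 ≤ c₁)
    (hΔ : Δ ∈ Icc Δ₁ Δ₂) (ha : a ∈ Icc a₁ a₂) (hb : b ∈ Icc b₁ b₂) (hc : c ∈ Icc c₁ c₂) (hν0 : 0 < ν) (hν1 : ν < 1)
    (hEl0 : 0 < El) (hEl : El ≤ fermiEnergyOf Δ₂ a₁ b₁ c₂ ν) (hEh : fermiEnergyOf Δ₁ a₂ b₂ c₁ ν ≤ Eh) (hm : c₂ * Eh < a₁ ^ 2)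
    (hlev : c₂ * (2 * Δ₁ * Eh + Eh ^ 2) ≤ a₁ ^ 2 * Δ₁) :
    dWeightAxis Δ a b c (fermiEnergyOf Δ a b c ν) ∈ Icc (dWeightAxisCF Δ₁ a₂ c₁ Eh) (dWeightAxisCF Δ₂ a₁ c₂ El) := by
  have hΔ0 : 0 < Δ := lt_of_lt_of_le hΔ₁ hΔ.1
  have ha0 : 0 < a := lt_of_lt_of_le ha₁ ha.1
  have hc0 : 0 ≤ c := hc₁.trans hc.1
  have hb0 : 0 ≤ b := hb₁.trans hb.1
  have hc₂ : 0 ≤ c₂ := hc0.trans hc.2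
  have hbox := fermiEnergyOf_mem_Icc_of_mem_box' hΔ₁ ha₁ hb₁ hc₁ hΔ ha hb hc hν0 hν1
  set E := fermiEnergyOf Δ a b c ν with hE
  have hEl' : El ≤ E := hEl.trans hbox.1
  have hEh' : E ≤ Eh := hbox.2.trans hEh
  have hE0 : 0 < E := lt_of_lt_of_le hEl0 hEl'
  have hEh0 : 0 ≤ Eh := hE0.le.trans hEh'
  have haa : a₁ ^ 2 ≤ a ^ 2 := by nlinarith [ha.1]
  have haa' : a ^ 2 ≤ a₂ ^ 2 := by nlinarith [ha.2]
  have hmEh : c * Eh < a ^ 2 :=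
    calc c * Eh ≤ c₂ * Eh := mul_le_mul_of_nonneg_right hc.2 hEh0
      _ < a₁ ^ 2 := hm
      _ ≤ a ^ 2 := haa
  have hmE : c * E < a ^ 2 := lt_of_le_of_lt (mul_le_mul_of_nonneg_left hEh' hc0) hmEh
  have hmEl : c * El < a ^ 2 := lt_of_le_of_lt (mul_le_mul_of_nonneg_left hEl' hc0) hmE
  -- the energy-lever margin holds at every Δ ≥ Δ₁ (the slack a₁² − 2c₂E_h ≥ 0 grows the right side faster)
  have hslack : 0 ≤ a₁ ^ 2 - 2 * c₂ * Eh := by nlinarith [sq_nonneg Eh, hΔ₁]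
  have hΔm : c₂ * (2 * Δ * Eh + Eh ^ 2) ≤ a₁ ^ 2 * Δ := by nlinarith [hΔ.1]
  have hΔm' : c₂ * (2 * Δ * Eh + Eh ^ 2) ≤ a ^ 2 * Δ := hΔm.trans (mul_le_mul_of_nonneg_right haa hΔ0.le)
  rw [dWeightAxis_eq_CF (by linarith) hE0 ha0.ne' hmE]
  constructor
  · -- floor: CF(Δ₁, a₂, c₁; E_h) ≤ CF(Δ₁, a₂, c; E_h) ≤ CF(Δ₁, a, c; E_h) ≤ CF(Δ, a, c; E_h) ≤ CF(Δ, a, c; E)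
    have hmEh₂ : c * Eh < a₂ ^ 2 := lt_of_lt_of_le hmEh haa'
    have s1 : dWeightAxisCF Δ₁ a₂ c₁ Eh ≤ dWeightAxisCF Δ₁ a₂ c Eh := dWeightAxisCF_mono_tppP hΔ₁ hEh0 hc₁ hc.1 hmEh₂
    have s2 : dWeightAxisCF Δ₁ a₂ c Eh ≤ dWeightAxisCF Δ₁ a c Eh := dWeightAxisCF_anti_tpd hΔ₁ ha0 ha.2 hEh0 hc0 hmEh
    have s3 : dWeightAxisCF Δ₁ a c Eh ≤ dWeightAxisCF Δ a c Eh := dWeightAxisCF_mono_Delta hΔ₁ hΔ.1 hEh0 hc0 hmEh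
    have s4 : dWeightAxisCF Δ a c Eh ≤ dWeightAxisCF Δ a c E := by
      refine dWeightAxisCF_anti_eps hΔ0 hc0 hE0.le hEh' hmEh ?_
      have hin : Δ * (E + Eh) + E * Eh ≤ 2 * Δ * Eh + Eh ^ 2 := by nlinarith [hE0.le]
      calc c * (Δ * (E + Eh) + E * Eh) ≤ c * (2 * Δ * Eh + Eh ^ 2) := mul_le_mul_of_nonneg_left hin hc0
        _ ≤ c₂ * (2 * Δ * Eh + Eh ^ 2) := mul_le_mul_of_nonneg_right hc.2 (by positivity)
        _ ≤ a ^ 2 * Δ := hΔm'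
    exact s1.trans (s2.trans (s3.trans s4))
  · -- ceiling: CF(Δ, a, c; E) ≤ CF(Δ, a, c; E_l) ≤ CF(Δ₂, a, c; E_l) ≤ CF(Δ₂, a₁, c; E_l) ≤ CF(Δ₂, a₁, c₂; E_l)
    have hΔ₂ : 0 < Δ₂ := lt_of_lt_of_le hΔ0 hΔ.2
    have hmEl₁ : c * El < a₁ ^ 2 := lt_of_le_of_lt (mul_le_mul_of_nonneg_right hc.2 hEl0.le) (lt_of_le_of_lt (mul_le_mul_of_nonneg_left (hEl'.trans hEh') hc₂) hm)
    have hmEl₂ : c₂ * El < a₁ ^ 2 := lt_of_le_of_lt (mul_le_mul_of_nonneg_left (hEl'.trans hEh') hc₂) hm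
    have s1 : dWeightAxisCF Δ a c E ≤ dWeightAxisCF Δ a c El := by
      refine dWeightAxisCF_anti_eps hΔ0 hc0 hEl0.le hEl' hmE ?_
      have hin : Δ * (El + E) + El * E ≤ 2 * Δ * Eh + Eh ^ 2 := by nlinarith [hEl0.le, hE0.le]
      calc c * (Δ * (El + E) + El * E) ≤ c * (2 * Δ * Eh + Eh ^ 2) := mul_le_mul_of_nonneg_left hin hc0
        _ ≤ c₂ * (2 * Δ * Eh + Eh ^ 2) := mul_le_mul_of_nonneg_right hc.2 (by positivity)
        _ ≤ a ^ 2 * Δ := hΔm'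
    have s2 : dWeightAxisCF Δ a c El ≤ dWeightAxisCF Δ₂ a c El := dWeightAxisCF_mono_Delta hΔ0 hΔ.2 hEl0.le hc0 hmEl
    have s3 : dWeightAxisCF Δ₂ a c El ≤ dWeightAxisCF Δ₂ a₁ c El := dWeightAxisCF_anti_tpd hΔ₂ ha₁ ha.1 hEl0.le hc0 hmEl₁
    have s4 : dWeightAxisCF Δ₂ a₁ c El ≤ dWeightAxisCF Δ₂ a₁ c₂ El := dWeightAxisCF_mono_tppP hΔ₂ hEl0.le hc0 hc.2 hmEl₂
    exact s1.trans (s2.trans (s3.trans s4))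

/-- **Numeric form** of the axis-weight window: with rationals `lo ≤ dWeightAxisCF(Δ₁, a₂, c₁; E_h)` and `dWeightAxisCF(Δ₂, a₁, c₂; E_l) ≤ hi` (by `norm_num [dWeightAxisCF]`),
every member has `w_axis(θ; ε_F(θ; ν)) ∈ [lo, hi]`. [folklore] -/
theorem dWeightAxis_fermiEnergyOf_mem_Icc_of_mem_box_num {Δ a b c Δ₁ Δ₂ a₁ a₂ b₁ b₂ c₁ c₂ ν El Eh lo hi : ℝ} (hΔ₁ : 0 < Δ₁) (ha₁ : 0 < a₁) (hb₁ : 0 ≤ b₁)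
    (hc₁ : 0 ≤ c₁) (hΔ : Δ ∈ Icc Δ₁ Δ₂) (ha : a ∈ Icc a₁ a₂) (hb : b ∈ Icc b₁ b₂) (hc : c ∈ Icc c₁ c₂) (hν0 : 0 < ν) (hν1 : ν < 1)
    (hEl0 : 0 < El) (hEl : El ≤ fermiEnergyOf Δ₂ a₁ b₁ c₂ ν) (hEh : fermiEnergyOf Δ₁ a₂ b₂ c₁ ν ≤ Eh) (hm : c₂ * Eh < a₁ ^ 2)
    (hlev : c₂ * (2 * Δ₁ * Eh + Eh ^ 2) ≤ a₁ ^ 2 * Δ₁) (hlo : lo ≤ dWeightAxisCF Δ₁ a₂ c₁ Eh) (hhi : dWeightAxisCF Δ₂ a₁ c₂ El ≤ hi) :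
    dWeightAxis Δ a b c (fermiEnergyOf Δ a b c ν) ∈ Icc lo hi := by
  have h := dWeightAxis_fermiEnergyOf_mem_Icc_of_mem_box hΔ₁ ha₁ hb₁ hc₁ hΔ ha hb hc hν0 hν1 hEl0 hEl hEh hm hlev
  exact ⟨hlo.trans h.1, h.2.trans hhi⟩

/-- **ELECTRON-LIKE OVER A WHOLE BOX**: if `x_VH(θ) ≤ X` for every member (e.g. `X = 1 − 2Ψ(q₂)` from `xVH_window_of_vhBoxCheck` and a table entry) and `X < 1 − 2ν`,
then every member's Fermi surface at filling `ν` is electron-like: `faceG(θ; ε_F) < 0`; with `c₂E_h < a₁²` also `xAxis(θ; ε_F) < 1`. [folklore] -/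
theorem electronLike_of_xVH_le {Δ a b c ν X Eh c₂ a₁ : ℝ} (hΔ : 0 < Δ) (ha : 0 < a) (hc : 0 ≤ c) (hb : 0 ≤ b) (hν0 : 0 < ν) (hν1 : ν < 1)
    (hxX : xVH Δ a b c ≤ X) (hX : X < 1 - 2 * ν) (hEh : fermiEnergyOf Δ a b c ν ≤ Eh) (hcc : c ≤ c₂) (haa : a₁ ≤ a) (ha₁ : 0 < a₁) (hm : c₂ * Eh < a₁ ^ 2) :
    faceG Δ a c (fermiEnergyOf Δ a b c ν) < 0 ∧ xAxis Δ a c (fermiEnergyOf Δ a b c ν) < 1 := by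
  have hx : xVH Δ a b c < 1 - 2 * ν := lt_of_le_of_lt hxX hX
  have hG := faceG_fermiEnergyOf_neg_of_xVH_lt hΔ ha.ne' hc hb hν0 hν1 hx
  have hE0 := fermiEnergyOf_pos hΔ ha.ne' hc hb hν0 hν1
  have hmE : c * fermiEnergyOf Δ a b c ν < a ^ 2 :=
    calc c * fermiEnergyOf Δ a b c ν ≤ c₂ * Eh := mul_le_mul hcc hEh hE0.le (hc.trans hcc)
      _ < a₁ ^ 2 := hm
      _ ≤ a ^ 2 := by nlinarith
  exact ⟨hG, xAxis_lt_one_of_faceG_neg hmE hG⟩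

end Summit.Ventures.CertifiedManyBodySolver.Downfold.Emery
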